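import Literature.Geometry.Lorentzian.CoordBianchi
import HarnessLib

/-!
# Ricci-parallel (Einstein) metric components have harmonic curvature: `div R = 0`

Continuation of `CoordBianchi.lean` (namespace `MetricCoord`: components
`G : E → (E →L E →L ℝ)` of a pseudo-Riemannian metric, smooth, symmetric and nondegenerate on an
open set `V` (`IsMetricOn G V`), Christoffel map `chrAt`, curvature endomorphism `riemAt`, Ricci
form `ricAt`, covariant derivatives `cov₂At` of fields of bilinear forms and `covRiemAt` of the
curvature endomorphism along constant fields, second Bianchi identity `covRiemAt_cyclic`,
`sum_coord_covRiemAt` (contraction commutes with `∇`)). Everything here is PROVED; no statement of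
`Prop` type is introduced.

* `IsMetricOn.sum_coord_covRiemAt_first` — **the divergence form of the second Bianchi identity**
  (O'Neill 1983, Ch. 3, Prop. 3.37 traced over the derivative slot and the endomorphism slot;
  Besse 1987, 16.3: `δR = −d^∇ r`, i.e. `(δR)(X,Y,Z)`-type contraction equals the alternation of
  `∇r`): in any basis `b`, `Σᵢ bⁱ((∇_{bᵢ} R)(X,Y)Z) = (∇_X Ric)(Y,Z) − (∇_Y Ric)(X,Z)`.
* `IsMetricOn.cov₂At_self` — metric compatibility `∇G = 0` (O'Neill 1983, Ch. 3, Prop. 3.13).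
* `IsMetricOn.cov₂At_ricAt_of_einstein` — **Einstein components are Ricci-parallel**: if
  `Ric = λ G` on `V` then `∇Ric = 0` on `V`.
* `IsMetricOn.sum_coord_covRiemAt_first_eq_zero_of_ricciParallel`,
  `IsMetricOn.sum_coord_covRiemAt_first_eq_zero_of_einstein` — **Ricci-parallel, in particular
  Einstein, metric components have harmonic curvature** `Σᵢ bⁱ((∇_{bᵢ} R)(X,Y)Z) = 0`
  (Besse 1987, 16.4 and Prop. 16.5 / 16.24 (i): `Dr = 0` implies `δR = 0`, and then also
  `δW = 0`; the first step of Gursky–LeBrun 1999, §3, (div): "the given metric `g` is assumed to be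
  Einstein. The second Bianchi identity therefore tells us that its self-dual Weyl curvature is
  harmonic").

Only the full curvature tensor is treated here; the passage to the Weyl tensor (and to `W⁺` in
dimension four), `δW = δR − ((n−3)/(n−2)) d^∇P` with the Schouten tensor `P` parallel for
Einstein components, needs the coordinate Weyl tensor, which this framework does not yet define.

## References

* B. O'Neill, *Semi-Riemannian geometry*, Academic Press 1983, Ch. 3, Prop. 3.13, Prop. 3.37,
  Cor. 3.54. [ONeill1983]
* A. L. Besse, *Einstein manifolds*, Springer 1987, 16.3–16.5, 16.24. [Besse1987]
* M. J. Gursky, C. LeBrun, Ann. Global Anal. Geom. 17 (1999) 315–328 (arXiv:math/9807055), §3,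
  (div). [GurskyLebrun1999]
-/

noncomputable section

set_option maxSynthPendingDepth 3

open Set Filter ContinuousLinearMap Module
open scoped Topology ContDiff

namespace Literature.Geometry.Lorentzian

namespace MetricCoord

variable {E : Type*} [NormedAddCommGroup E] [NormedSpace ℝ E]

section Parallel

variable [FiniteDimensional ℝ E] {G : E → E →L[ℝ] E →L[ℝ] ℝ} {V : Set E} {x : E}

omit [FiniteDimensional ℝ E] in
/-- **Metric compatibility `∇G = 0`**: `∂_W G(Y,Z) − G(Γ(W,Y),Z) − G(Y,Γ(W,Z)) = 0`
(O'Neill 1983, Ch. 3, Prop. 3.13 / Thm. 3.11 (D4) on constant fields). [cite: ONeill1983, Ch. 3, Prop. 3.13] -/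
theorem IsMetricOn.cov₂At_self (hG : IsMetricOn G V) (hx : x ∈ V) : cov₂At G G x = 0 := by
  ext W Y Z
  rw [cov₂At_apply, hG.fderiv_eq_chrAt hx W Y Z]
  simp

/-- **Einstein metric components are Ricci-parallel**: if `Ric = λ G` on the open set `V` then
`∇Ric = λ ∇G = 0` on `V` (Besse 1987, 16.4: Einstein ⟹ parallel Ricci tensor).
[cite: Besse1987, 16.4] -/
theorem IsMetricOn.cov₂At_ricAt_of_einstein (hG : IsMetricOn G V) (hx : x ∈ V) {lam : ℝ}
    (hE : ∀ y ∈ V, ricAt G y = lam • G y) : cov₂At G (ricAt G) x = 0 := by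
  have hev : ricAt G =ᶠ[𝓝 x] fun y ↦ lam • G y := (hG.eventually_mem hx).mono hE
  have hD : fderiv ℝ (ricAt G) x = lam • fderiv ℝ G x := by
    rw [hev.fderiv_eq]
    exact fderiv_const_smul (hG.differentiableAt hx) lam
  ext W Y Z
  have h0 := congrArg (fun T : E →L[ℝ] E →L[ℝ] E →L[ℝ] ℝ ↦ T W Y Z) (hG.cov₂At_self hx)
  simp only [cov₂At_apply, _root_.zero_apply] at h0
  rw [cov₂At_apply, hD, hE x hx]
  simp only [_root_.smul_apply, smul_eq_mul, _root_.zero_apply]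
  have : lam * (fderiv ℝ G x W Y Z - G x (chrAt G x W Y) Z - G x Y (chrAt G x W Z)) = 0 := by
    rw [h0, mul_zero]
  linarith

end Parallel

section Divergence

variable {ι : Type*} [Fintype ι] [FiniteDimensional ℝ E] [CompleteSpace E]
  {G : E → E →L[ℝ] E →L[ℝ] ℝ} {V : Set E} {x : E} (b : Basis ι ℝ E)

/-- **The divergence form of the second Bianchi identity**: tracing
`(∇_W R)(X,Y) + (∇_X R)(Y,W) + (∇_Y R)(W,X) = 0` (`covRiemAt_cyclic`) over `W` against the output
slot gives, with `tr (W ↦ (∇_X R)(W,Y)Z) = (∇_X Ric)(Y,Z)` (`sum_coord_covRiemAt`),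
`Σᵢ bⁱ((∇_{bᵢ} R)(X,Y)Z) = (∇_X Ric)(Y,Z) − (∇_Y Ric)(X,Z)` — the contracted second Bianchi
identity `δR = −d^∇ r` (Besse 1987, 16.3; O'Neill 1983, Ch. 3, Prop. 3.37 with Cor. 3.54).
[cite: Besse1987, 16.3] [cite: ONeill1983, Ch. 3, Prop. 3.37] -/
theorem IsMetricOn.sum_coord_covRiemAt_first (hG : IsMetricOn G V) (hx : x ∈ V) (X Y Z : E) :
    ∑ i, b.coord i (covRiemAt G x (b i) X Y Z) =
      cov₂At G (ricAt G) x X Y Z - cov₂At G (ricAt G) x Y X Z := by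
  have hcyc : ∀ i, covRiemAt G x (b i) X Y Z + covRiemAt G x X Y (b i) Z +
      covRiemAt G x Y (b i) X Z = 0 := fun i ↦ by
    have h := congrArg (fun T : E →L[ℝ] E ↦ T Z) (hG.covRiemAt_cyclic hx (b i) X Y)
    simpa using h
  have hsum : ∑ i, b.coord i (covRiemAt G x (b i) X Y Z) +
      ∑ i, b.coord i (covRiemAt G x X Y (b i) Z) + ∑ i, b.coord i (covRiemAt G x Y (b i) X Z) = 0 := by
    rw [← Finset.sum_add_distrib, ← Finset.sum_add_distrib]
    refine Finset.sum_eq_zero fun i _ ↦ ?_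
    rw [← map_add, ← map_add, hcyc i, map_zero]
  have h2 : ∑ i, b.coord i (covRiemAt G x X Y (b i) Z) = -cov₂At G (ricAt G) x X Y Z := by
    rw [← hG.sum_coord_covRiemAt b hx X Y Z, ← Finset.sum_neg_distrib]
    refine Finset.sum_congr rfl fun i _ ↦ ?_
    rw [covRiemAt_swap x X (b i) Y, _root_.neg_apply, map_neg]
  have h3 : ∑ i, b.coord i (covRiemAt G x Y (b i) X Z) = cov₂At G (ricAt G) x Y X Z :=
    hG.sum_coord_covRiemAt b hx Y X Z
  linarith

/-- **Ricci-parallel metric components have harmonic curvature** (`Dr = 0 ⟹ δR = 0`; Besse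
1987, 16.4 (ii) ⟹ (iv) and Prop. 16.5): if `(∇Ric)_x = 0` then `Σᵢ bⁱ((∇_{bᵢ} R)(X,Y)Z) = 0`
for all `X, Y, Z`. [cite: Besse1987, 16.4] -/
theorem IsMetricOn.sum_coord_covRiemAt_first_eq_zero_of_ricciParallel (hG : IsMetricOn G V)
    (hx : x ∈ V) (hpar : cov₂At G (ricAt G) x = 0) (X Y Z : E) :
    ∑ i, b.coord i (covRiemAt G x (b i) X Y Z) = 0 := by
  rw [hG.sum_coord_covRiemAt_first b hx X Y Z]
  have h1 : cov₂At G (ricAt G) x X Y Z = 0 := by rw [hpar]; rfl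
  have h2 : cov₂At G (ricAt G) x Y X Z = 0 := by rw [hpar]; rfl
  rw [h1, h2, sub_zero]

/-- **Einstein metric components have harmonic curvature**: if `Ric = λ G` on `V` then
`Σᵢ bⁱ((∇_{bᵢ} R)(X,Y)Z) = 0` at every point of `V` (Besse 1987, 16.4; the first step "(div)"
of Gursky–LeBrun 1999, §3, which then reads it on `W⁺`). [cite: Besse1987, 16.4]
[cite: GurskyLebrun1999, §3, (div)] -/
theorem IsMetricOn.sum_coord_covRiemAt_first_eq_zero_of_einstein (hG : IsMetricOn G V)
    (hx : x ∈ V) {lam : ℝ} (hE : ∀ y ∈ V, ricAt G y = lam • G y) (X Y Z : E) :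
    ∑ i, b.coord i (covRiemAt G x (b i) X Y Z) = 0 := by
  have hpar : cov₂At G (ricAt G) x = 0 := hG.cov₂At_ricAt_of_einstein hx hE
  exact hG.sum_coord_covRiemAt_first_eq_zero_of_ricciParallel b hx hpar X Y Z

end Divergence

end MetricCoord

end Literature.Geometry.Lorentzian

end
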